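import Summits.ABC.StewartYu.PadicG3TwoSizesThirdN
import Summits.ABC.StewartYu.PadicG3TwoArithN
import Summits.ABC.StewartYu.PadicG3TwoSatEnd
import Summits.ABC.StewartYu.PadicG3ExitCPrep
import HarnessLib

/-!
# Cell abc-stewartyu, WP-L.P(2) (crux r4 `PadicCoreTwoRat`, stmt-ABC-20504), record: SIZE ATOMS of the 𝔑-threaded schedule in the letters
# of `PadicG3Par` — the index `N`, the weights, the virtual far-height unit, the ϑ-box, `log cardBN`, the directional log `log Xb3N`

`Summits/ABC/StewartYu/PadicG3TwoArithBN.lean` — cell `abc-stewartyu`, route `YuMatveevShapeRat`, seat p3 (g10; memo-13 §1); sequel to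
`PadicG3TwoArithN`.  Theorems only: `N_le_L` (`N ≤ L/2^9`), `log_N_le_sub_G` (`log N ≤ log L − G`), `A_le_L`, `sum_A_le`,
`hboxvN_zero_le` / `hboxvN_le_of_pos` (virtual far-height units), `sum_sN_le`, `Dco_real_le`, `log_cardBN_le`, `exp_W_mul_L_le`,
`log_Xb3N_le` (`≤ 3·W_L + (2d+5)·log(d+1)`).  WHAT THIS IS NOT: the budget comparison; no crux moves.

References: Yu. V. Nesterenko, LNM 1819 (2003), §3.4 Prop 3.7, §3.5, §4.2 (4.26)–(4.35); K. Yu, Acta Math. 211 (2013), §3.1.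
-/

noncomputable section

open Finset Real
open scoped Nat
open Literature.NumberTheory.Transcendental
open Literature.NumberTheory.Transcendental.CW77.Setup (Tau tauNorm)

namespace Summit.ABC.StewartYu

namespace TwoSetup

open Summit.ABC.StewartYu.G3Boxes PadicG3Par

variable (S : TwoSetup) (F : S.SatData) (P : PadicG3Par (S.d + 1))

/-! ### The index `N` -/

/-- `Ω ≤ L/(24·C_bⁿ)` (`24 C_bⁿ Ω K ≤ L`, `K ≥ 1`). [folklore] -/
theorem Ω_le_L : P.Ω ≤ P.L / (24 * Cb ^ (S.d + 1)) := by
  have h := P.main_le_L'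
  have hK : (1 : ℝ) ≤ P.K := by exact_mod_cast P.one_le_K
  have hC : (0 : ℝ) < Cb ^ (S.d + 1) := by have := Cb_pos; positivity
  have hΩ := P.Ω_pos
  rw [le_div_iff₀ (by positivity)]
  nlinarith [mul_le_mul_of_nonneg_left hK (le_of_lt (mul_pos (mul_pos (by norm_num : (0:ℝ) < 24) hC) hΩ))]

/-- **`N ≤ L/2^9`** for `N ≤ (2/log 2)^{d+1}·Ω`. [cite: Nesterenko2003, §3.4 Prop 3.7; shape only] -/
theorem N_le_L (hN : (F.N : ℝ) ≤ (2 / Real.log 2) ^ (S.d + 1) * P.Ω) : (F.N : ℝ) ≤ P.L / 2 ^ 9 := by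
  have hΩ := S.Ω_le_L P
  have hl : (0.6931471803 : ℝ) < Real.log 2 := Real.log_two_gt_d9
  have hCb := sixtyfour_le_Cb
  have hL : (0 : ℝ) ≤ P.L := by linarith [P.one_le_L]
  -- `q := (2/log 2)/C_b ≤ 1/22`
  have hq : 2 / Real.log 2 / Cb ≤ 1 / 22 := by
    rw [div_div, div_le_div_iff₀ (by have := Cb_pos; positivity) (by norm_num)]
    nlinarith
  have hq0 : 0 ≤ 2 / Real.log 2 / Cb := by have := Cb_pos; positivity
  have hqn : (2 / Real.log 2 / Cb) ^ (S.d + 1) ≤ 2 / Real.log 2 / Cb := pow_le_of_le_one hq0 (by linarith) (by omega)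
  have e : (2 / Real.log 2) ^ (S.d + 1) * (P.L / (24 * Cb ^ (S.d + 1))) = (2 / Real.log 2 / Cb) ^ (S.d + 1) * P.L / 24 := by
    rw [div_pow, div_pow, div_pow]
    have : (0 : ℝ) < Cb ^ (S.d + 1) := by have := Cb_pos; positivity
    field_simp
  calc (F.N : ℝ) ≤ (2 / Real.log 2) ^ (S.d + 1) * P.Ω := hN
    _ ≤ (2 / Real.log 2) ^ (S.d + 1) * (P.L / (24 * Cb ^ (S.d + 1))) := mul_le_mul_of_nonneg_left hΩ (by positivity)
    _ = (2 / Real.log 2 / Cb) ^ (S.d + 1) * P.L / 24 := e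
    _ ≤ (1 / 22) * P.L / 24 := by gcongr; exact hqn.trans hq
    _ ≤ P.L / 2 ^ 9 := by rw [div_le_div_iff₀ (by norm_num) (by norm_num)]; nlinarith

/-- `N ≤ L` (natural numbers). [folklore] -/
theorem N_le_L_nat (hN : (F.N : ℝ) ≤ (2 / Real.log 2) ^ (S.d + 1) * P.Ω) : F.N ≤ P.L := by
  have h := S.N_le_L F P hN
  have hL : (0 : ℝ) ≤ P.L := by linarith [P.one_le_L]
  have : (F.N : ℝ) ≤ P.L := h.trans (by rw [div_le_iff₀ (by norm_num)]; nlinarith)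
  exact_mod_cast this

/-- `log N ≤ log L`. [folklore] -/
theorem log_N_le_log_L (hN : (F.N : ℝ) ≤ (2 / Real.log 2) ^ (S.d + 1) * P.Ω) : Real.log F.N ≤ Real.log P.L := by
  have hN1 : (1 : ℝ) ≤ F.N := by exact_mod_cast F.hN
  exact Real.log_le_log (by linarith) (by exact_mod_cast S.N_le_L_nat F P hN)

/-- `Aⱼ ≤ Ω` when all weights are `≥ 1`. [folklore] -/
theorem A_le_Ω (hA1 : ∀ j, 1 ≤ P.A j) (j : Fin (S.d + 1)) : P.A j ≤ P.Ω := by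
  unfold PadicG3Par.Ω
  rw [← Finset.mul_prod_erase Finset.univ P.A (Finset.mem_univ j)]
  have h1 : 1 ≤ ∏ i ∈ Finset.univ.erase j, P.A i := Finset.one_le_prod fun i _ => hA1 i
  have h0 : 0 ≤ P.A j := (P.A_pos j).le
  nlinarith

/-- **`Aⱼ ≤ L/2^10`.** [folklore] -/
theorem A_le_L (hA1 : ∀ j, 1 ≤ P.A j) (j : Fin (S.d + 1)) : P.A j ≤ (P.L : ℝ) / 2 ^ 10 := by
  have h := (S.A_le_Ω P hA1 j).trans (S.Ω_le_L P)
  refine h.trans ?_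
  have hL : (0 : ℝ) ≤ P.L := by linarith [P.one_le_L]
  have hC : (2 : ℝ) ^ 10 ≤ 24 * Cb ^ (S.d + 1) := by
    have h64 := sixtyfour_le_Cb
    have : (64 : ℝ) ≤ Cb ^ (S.d + 1) := by
      calc (64 : ℝ) = 64 ^ 1 := by norm_num
        _ ≤ Cb ^ 1 := by rw [pow_one, pow_one]; exact h64
        _ ≤ Cb ^ (S.d + 1) := pow_le_pow_right₀ (by linarith) (by omega)
    nlinarith
  exact div_le_div_of_nonneg_left hL (by positivity) hC

/-- `ΣAⱼ ≤ (d+1)·L/2^10`. [folklore] -/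
theorem sum_A_le (hA1 : ∀ j, 1 ≤ P.A j) : ∑ j, P.A j ≤ ((S.d : ℝ) + 1) * ((P.L : ℝ) / 2 ^ 10) := by
  calc ∑ j, P.A j ≤ ∑ _j : Fin (S.d + 1), ((P.L : ℝ) / 2 ^ 10) := Finset.sum_le_sum fun j _ => S.A_le_L P hA1 j
    _ = ((S.d : ℝ) + 1) * ((P.L : ℝ) / 2 ^ 10) := by
        rw [Finset.sum_const, Finset.card_univ, Fintype.card_fin, nsmul_eq_mul]; push_cast; ring

/-- `sN j ≤ L/(2Aⱼ) + 1`. [folklore] -/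
theorem sN_real_le (j : Fin (S.d + 1)) : (S.sN P j : ℝ) ≤ (P.L : ℝ) / (2 * P.A j) + 1 := by
  unfold sN; push_cast; linarith [P.side_le j]

/-- `sN j · (2Aⱼ) ≤ L + 2Aⱼ`. [folklore] -/
theorem sN_mul_le (j : Fin (S.d + 1)) : (S.sN P j : ℝ) * (2 * P.A j) ≤ P.L + 2 * P.A j := by
  have h := S.sN_real_le P j
  have hA := P.A_pos j
  have := mul_le_mul_of_nonneg_right h (by positivity : (0 : ℝ) ≤ 2 * P.A j)
  rwa [add_mul, one_mul, div_mul_cancel₀ _ (by positivity)] at this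

/-- **Level-`0` virtual far-height unit**: `hboxvN (2A) 0 ≤ (d+1)·L + 2ΣA` (`Bv3N 0 j/N = sN j`). [folklore] -/
theorem hboxvN_zero_le : S.hboxvN F P (fun j => 2 * P.A j) 0 ≤ ((S.d : ℝ) + 1) * P.L + 2 * ∑ j, P.A j := by
  unfold hboxvN
  have hN : (0 : ℝ) < F.N := by exact_mod_cast F.hN
  have hterm : ∀ j, ((S.Bv3N F P 0 j : ℝ) / F.N) * (2 * P.A j) ≤ P.L + 2 * P.A j := by
    intro j
    have e : ((S.Bv3N F P 0 j : ℝ) / F.N) = S.sN P j := by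
      rw [Bv3N_zero]; push_cast; field_simp
    rw [e]
    exact S.sN_mul_le P j
  calc ∑ j, ((S.Bv3N F P 0 j : ℝ) / F.N) * (2 * P.A j) ≤ ∑ j, (P.L + 2 * P.A j) := Finset.sum_le_sum fun j _ => hterm j
    _ = ((S.d : ℝ) + 1) * P.L + 2 * ∑ j, P.A j := by
        rw [Finset.sum_add_distrib, Finset.sum_const, Finset.card_univ, Fintype.card_fin, ← Finset.mul_sum, nsmul_eq_mul]
        push_cast; ring

/-- **Deep virtual far-height unit**: `hboxvN (2A) I ≤ (2/3^I)·((d+1)·L + 2ΣA)` for `I ≥ 1`. [cite: Nesterenko2003, (4.35); shape only] -/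
theorem hboxvN_le_of_pos {I : ℕ} (hI : 1 ≤ I) :
    S.hboxvN F P (fun j => 2 * P.A j) I ≤ 2 / (3 : ℝ) ^ I * (((S.d : ℝ) + 1) * P.L + 2 * ∑ j, P.A j) := by
  obtain ⟨I', rfl⟩ : ∃ I', I = I' + 1 := ⟨I - 1, by omega⟩
  unfold hboxvN
  have hN : (0 : ℝ) < F.N := by exact_mod_cast F.hN
  have h3 : (0 : ℝ) < (3 : ℝ) ^ (I' + 1) := by positivity
  have hterm : ∀ j, ((S.Bv3N F P (I' + 1) j : ℝ) / F.N) * (2 * P.A j) ≤ 2 / (3 : ℝ) ^ (I' + 1) * (P.L + 2 * P.A j) := by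
    intro j
    rw [Bv3N_succ]
    have hdiv : ((2 * (F.N * S.sN P j) / 3 ^ (I' + 1) : ℕ) : ℝ) ≤ (2 * (F.N * S.sN P j) : ℕ) / (3 : ℝ) ^ (I' + 1) := by
      rw [le_div_iff₀ h3]; exact_mod_cast Nat.div_mul_le_self _ _
    have hA := P.A_pos j
    calc ((2 * (F.N * S.sN P j) / 3 ^ (I' + 1) : ℕ) : ℝ) / F.N * (2 * P.A j)
        ≤ ((2 * (F.N * S.sN P j) : ℕ) / (3 : ℝ) ^ (I' + 1)) / F.N * (2 * P.A j) := by gcongr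
      _ = 2 / (3 : ℝ) ^ (I' + 1) * ((S.sN P j : ℝ) * (2 * P.A j)) := by push_cast; field_simp
      _ ≤ 2 / (3 : ℝ) ^ (I' + 1) * (P.L + 2 * P.A j) := mul_le_mul_of_nonneg_left (S.sN_mul_le P j) (by positivity)
  calc ∑ j, ((S.Bv3N F P (I' + 1) j : ℝ) / F.N) * (2 * P.A j) ≤ ∑ j, 2 / (3 : ℝ) ^ (I' + 1) * (P.L + 2 * P.A j) :=
        Finset.sum_le_sum fun j _ => hterm j
    _ = 2 / (3 : ℝ) ^ (I' + 1) * (((S.d : ℝ) + 1) * P.L + 2 * ∑ j, P.A j) := by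
        rw [← Finset.mul_sum, Finset.sum_add_distrib, Finset.sum_const, Finset.card_univ, Fintype.card_fin, ← Finset.mul_sum,
          nsmul_eq_mul]
        push_cast; ring

/-! ### The ϑ-box and `log cardBN` -/

/-- `Σⱼ sN j ≤ (d+1)·L` (weights `≥ 1`, `L ≥ 2`). [folklore] -/
theorem sum_sN_le (hA1 : ∀ j, 1 ≤ P.A j) : ((∑ j, S.sN P j : ℕ) : ℝ) ≤ ((S.d : ℝ) + 1) * P.L := by
  have hL : (2 : ℝ) ^ 25 ≤ P.L := P.two_pow_25_le_L
  have hterm : ∀ j, (S.sN P j : ℝ) ≤ P.L := by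
    intro j
    have h := S.sN_real_le P j
    have hA := hA1 j
    have h2 : (P.L : ℝ) / (2 * P.A j) ≤ P.L / 2 := div_le_div_of_nonneg_left (by positivity) (by norm_num) (by linarith)
    linarith [show (2:ℝ) ≤ 2^25 by norm_num]
  push_cast
  calc ∑ j, (S.sN P j : ℝ) ≤ ∑ _j : Fin (S.d + 1), (P.L : ℝ) := Finset.sum_le_sum fun j _ => hterm j
    _ = ((S.d : ℝ) + 1) * P.L := by rw [Finset.sum_const, Finset.card_univ, Fintype.card_fin, nsmul_eq_mul]; push_cast; ring

/-- **`Dco ≤ (d+1)!·(d+1)·N·L`.** [folklore] -/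
theorem Dco_real_le (hA1 : ∀ j, 1 ≤ P.A j) :
    (S.Dco F P : ℝ) ≤ (((S.d + 1)! : ℕ) : ℝ) * (((S.d : ℝ) + 1) * (F.N * P.L)) := by
  unfold Dco
  have h := S.sum_sN_le P hA1
  push_cast at h ⊢
  have hN : (0 : ℝ) ≤ F.N := by positivity
  have hf : (0 : ℝ) ≤ (((S.d + 1)! : ℕ) : ℝ) := by positivity
  calc (((S.d + 1)! : ℕ) : ℝ) * (F.N : ℝ) * ∑ j, (S.sN P j : ℝ) ≤ (((S.d + 1)! : ℕ) : ℝ) * (F.N : ℝ) * (((S.d : ℝ) + 1) * P.L) :=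
        mul_le_mul_of_nonneg_left h (by positivity)
    _ = _ := by ring

/-- `log(2·Dco + 1) ≤ (d+2)·log(d+1) + 2·log L` (for `N ≤ L/2^9`, weights `≥ 1`). [folklore] -/
theorem log_two_Dco_add_one_le (hA1 : ∀ j, 1 ≤ P.A j) (hN : (F.N : ℝ) ≤ (2 / Real.log 2) ^ (S.d + 1) * P.Ω) :
    Real.log ((2 * S.Dco F P + 1 : ℕ) : ℝ) ≤ ((S.d : ℝ) + 2) * Real.log ((S.d : ℝ) + 1) + 2 * Real.log P.L := by
  have hD := S.Dco_real_le F P hA1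
  have hNL := S.N_le_L F P hN
  have hL : (2 : ℝ) ^ 25 ≤ P.L := P.two_pow_25_le_L
  have hL0 : (0 : ℝ) < P.L := by linarith [show (0:ℝ) < 2^25 by norm_num]
  have hd1 : (1 : ℝ) ≤ (S.d : ℝ) + 1 := by
    have h0 : (0 : ℝ) ≤ S.d := Nat.cast_nonneg _
    linarith
  -- `(d+1)! ≤ (d+1)^{d+1}`
  have hfact : (((S.d + 1)! : ℕ) : ℝ) ≤ ((S.d : ℝ) + 1) ^ (S.d + 1) := by
    have := Nat.factorial_le_pow (S.d + 1); exact_mod_cast this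
  -- `2 Dco + 1 ≤ (d+1)^{d+2} L²`
  have hpow : (1 : ℝ) ≤ ((S.d : ℝ) + 1) ^ (S.d + 1) := one_le_pow₀ hd1
  have h2 : (((2 * S.Dco F P + 1 : ℕ)) : ℝ) ≤ ((S.d : ℝ) + 1) ^ (S.d + 2) * (P.L : ℝ) ^ 2 := by
    push_cast
    have hNL' : (F.N : ℝ) * P.L ≤ P.L ^ 2 / 2 ^ 9 := by
      rw [pow_two, le_div_iff₀ (by norm_num)]; nlinarith
    have e : ((S.d : ℝ) + 1) ^ (S.d + 2) = ((S.d : ℝ) + 1) ^ (S.d + 1) * ((S.d : ℝ) + 1) := by rw [pow_succ]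
    rw [e]
    have h3 : (S.Dco F P : ℝ) ≤ ((S.d : ℝ) + 1) ^ (S.d + 1) * (((S.d : ℝ) + 1) * (P.L ^ 2 / 2 ^ 9)) := by
      calc (S.Dco F P : ℝ) ≤ (((S.d + 1)! : ℕ) : ℝ) * (((S.d : ℝ) + 1) * (F.N * P.L)) := hD
        _ ≤ ((S.d : ℝ) + 1) ^ (S.d + 1) * (((S.d : ℝ) + 1) * (P.L ^ 2 / 2 ^ 9)) := by gcongr
    have hL2 : (2 : ℝ) ^ 50 ≤ (P.L : ℝ) ^ 2 := by nlinarith [show (0:ℝ) ≤ 2^25 by norm_num]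
    nlinarith [mul_le_mul hpow hd1 (by norm_num) (by positivity)]
  have hpos : (0 : ℝ) < ((2 * S.Dco F P + 1 : ℕ) : ℝ) := by positivity
  calc Real.log ((2 * S.Dco F P + 1 : ℕ) : ℝ) ≤ Real.log (((S.d : ℝ) + 1) ^ (S.d + 2) * (P.L : ℝ) ^ 2) := Real.log_le_log hpos h2
    _ = ((S.d : ℝ) + 2) * Real.log ((S.d : ℝ) + 1) + 2 * Real.log P.L := by
        rw [Real.log_mul (by positivity) (by positivity), Real.log_pow, Real.log_pow]; push_cast; ring

/-- **`log cardBN ≤ log(L₀+1) + (d+1)·((d+2)·log(d+1) + 2·log L)`.** [folklore] -/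
theorem log_cardBN_le (hA1 : ∀ j, 1 ≤ P.A j) (hN : (F.N : ℝ) ≤ (2 / Real.log 2) ^ (S.d + 1) * P.Ω) :
    Real.log (S.cardBN F P : ℝ) ≤ Real.log ((P.L₀ : ℝ) + 1) +
      ((S.d : ℝ) + 1) * (((S.d : ℝ) + 2) * Real.log ((S.d : ℝ) + 1) + 2 * Real.log P.L) := by
  rw [S.log_cardBN_eq F P]
  have h1 : Real.log ((S.L03N F P + 1 : ℕ) : ℝ) ≤ Real.log ((P.L₀ : ℝ) + 1) := by
    push_cast
    exact Real.log_le_log (by positivity) (by have := S.L03N_le_L₀ F P; exact_mod_cast (by omega : S.L03N F P + 1 ≤ P.L₀ + 1))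
  have h2 := S.log_two_Dco_add_one_le F P hA1 hN
  have hd0 : (0 : ℝ) ≤ S.d := by positivity
  nlinarith

/-! ### The directional log -/

/-- `e^W · L ≤ e^{W_L}/(2e)` (`W + log(2L) + 1 ≤ W_L`). [folklore] -/
theorem exp_W_mul_L_le : Real.exp P.W * P.L ≤ Real.exp P.WL / (2 * Real.exp 1) := by
  have h := P.W_add_log_le_WL
  have hL : (0 : ℝ) < P.L := by linarith [P.one_le_L]
  have he := Real.exp_le_exp.mpr h
  rw [Real.exp_add, Real.exp_add, Real.exp_log (by positivity)] at he
  rw [le_div_iff₀ (by positivity)]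
  nlinarith [Real.exp_pos P.W, Real.exp_pos 1]

/-- **The directional log of the 𝔑-threaded schedule**: for `|b̃ₖ| ≤ (d+1)·(d+1)!·N·e^W` (all `k`), weights `≥ 1` and
`N ≤ (2/log 2)^{d+1}Ω`: `log Xb3N I ≤ 3·W_L + (2d+5)·log(d+1)`. [cite: Nesterenko2003, §4.2 (4.26); shape only] -/
theorem log_Xb3N_le (hA1 : ∀ j, 1 ≤ P.A j) (hN : (F.N : ℝ) ≤ (2 / Real.log 2) ^ (S.d + 1) * P.Ω)
    (hball : ∀ k, (|S.ball k| : ℝ) ≤ (((S.d + 1) * (S.d + 1)! : ℕ) : ℝ) * F.N * Real.exp P.W) (I : ℕ) :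
    Real.log (S.Xb3N F P I : ℝ) ≤ 3 * P.WL + (2 * (S.d : ℝ) + 5) * Real.log ((S.d : ℝ) + 1) := by
  have hNL := S.N_le_L F P hN
  have hN0 : (0 : ℝ) < F.N := by exact_mod_cast F.hN
  have hD := S.Dco_real_le F P hA1
  have hL : (2 : ℝ) ^ 25 ≤ P.L := P.two_pow_25_le_L
  have hL0 : (0 : ℝ) < P.L := by linarith [show (0:ℝ) < 2^25 by norm_num]
  have hd1 : (1 : ℝ) ≤ (S.d : ℝ) + 1 := by
    have h0 : (0 : ℝ) ≤ S.d := Nat.cast_nonneg _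
    linarith
  have hW := S.exp_W_mul_L_le P
  have hlogL := P.log_L_le_WL
  -- `Σₖ |b̃ₖ| = |b̃_θ| + Σⱼ |b̃ⱼ| ≤ (d+1)·Bb`
  set Bb : ℝ := (((S.d + 1) * (S.d + 1)! : ℕ) : ℝ) * F.N * Real.exp P.W with hBb
  have hBb0 : 0 ≤ Bb := by positivity
  have hsumb : (|(S.bθ : ℝ)| + ∑ j, |(S.b j : ℝ)|) ≤ ((S.d : ℝ) + 1) * Bb := by
    have hθ : (|(S.bθ : ℝ)|) ≤ Bb := by have := hball (Fin.last S.d); unfold ball at this; simpa using this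
    have hj : ∀ j, (|(S.b j : ℝ)|) ≤ Bb := by
      intro j; have := hball (Fin.castSucc j); unfold ball at this; simpa using this
    calc (|(S.bθ : ℝ)| + ∑ j, |(S.b j : ℝ)|) ≤ Bb + ∑ _j : Fin S.d, Bb := add_le_add hθ (Finset.sum_le_sum fun j _ => hj j)
      _ = ((S.d : ℝ) + 1) * Bb := by rw [Finset.sum_const, Finset.card_univ, Fintype.card_fin]; ring
  -- `DcoR I ≤ Dco`
  have hDcoR : (S.DcoR F P I : ℝ) ≤ S.Dco F P := by
    have : S.DcoR F P I ≤ S.Dco F P := by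
      unfold DcoR; split_ifs with hI
      · exact le_rfl
      · have h3 : 3 ≤ 3 ^ I := by
          calc 3 = 3 ^ 1 := by norm_num
            _ ≤ 3 ^ I := Nat.pow_le_pow_right (by norm_num) (by omega)
        calc 2 * S.Dco F P / 3 ^ I ≤ 2 * S.Dco F P / 3 := Nat.div_le_div_left h3 (by norm_num)
          _ ≤ S.Dco F P := by omega
    exact_mod_cast this
  -- `Xb3N I ≤ 1 + (d+1)·Bb·Dco`
  have hX : (S.Xb3N F P I : ℝ) ≤ 1 + ((S.d : ℝ) + 1) * Bb * S.Dco F P := by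
    unfold Xb3N; push_cast
    have h0 : (0 : ℝ) ≤ (S.DcoR F P I : ℝ) := by positivity
    nlinarith [mul_le_mul hsumb hDcoR h0 (by positivity)]
  -- the product in closed form: `(d+1)·Bb·Dco ≤ (d+1)^{2d+5} · L^3 · e^{W_L} / (2^18 · 2e)`
  have hfact : (((S.d + 1)! : ℕ) : ℝ) ≤ ((S.d : ℝ) + 1) ^ (S.d + 1) := by
    have := Nat.factorial_le_pow (S.d + 1); exact_mod_cast this
  have hf0 : (0 : ℝ) ≤ (((S.d + 1)! : ℕ) : ℝ) := by positivity
  set D1 : ℝ := ((S.d : ℝ) + 1) with hD1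
  have hprod : D1 * Bb * S.Dco F P ≤ D1 ^ (2 * S.d + 5) * ((P.L : ℝ) ^ 2 * Real.exp P.WL) := by
    -- `Bb ≤ D1^{d+2} · N · e^W`, `Dco ≤ D1^{d+2} · N · L`
    have hBb' : Bb ≤ D1 ^ (S.d + 2) * (F.N * Real.exp P.W) := by
      rw [hBb]; push_cast
      calc ((S.d : ℝ) + 1) * (((S.d + 1)! : ℕ) : ℝ) * F.N * Real.exp P.W
          ≤ ((S.d : ℝ) + 1) * ((S.d : ℝ) + 1) ^ (S.d + 1) * F.N * Real.exp P.W := by gcongr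
        _ = D1 ^ (S.d + 2) * (F.N * Real.exp P.W) := by rw [hD1]; ring
    have hDco' : (S.Dco F P : ℝ) ≤ D1 ^ (S.d + 2) * (F.N * P.L) := by
      calc (S.Dco F P : ℝ) ≤ (((S.d + 1)! : ℕ) : ℝ) * (((S.d : ℝ) + 1) * (F.N * P.L)) := hD
        _ ≤ ((S.d : ℝ) + 1) ^ (S.d + 1) * (((S.d : ℝ) + 1) * (F.N * P.L)) := by gcongr
        _ = D1 ^ (S.d + 2) * (F.N * P.L) := by rw [hD1]; ring
    have hNN : (F.N : ℝ) * F.N ≤ P.L * P.L / 2 ^ 18 := by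
      rw [le_div_iff₀ (by norm_num)]; nlinarith
    have hcore : (F.N * Real.exp P.W) * (F.N * P.L) ≤ (P.L : ℝ) ^ 2 * Real.exp P.WL := by
      have e1 : (F.N * Real.exp P.W) * (F.N * P.L) = (F.N * F.N) * (Real.exp P.W * P.L) := by ring
      rw [e1]
      have h1 : (F.N * F.N) * (Real.exp P.W * P.L) ≤ (P.L * P.L / 2 ^ 18) * (Real.exp P.WL / (2 * Real.exp 1)) :=
        mul_le_mul hNN hW (by have := Real.exp_pos P.W; positivity) (by positivity)
      refine h1.trans ?_
      have he : (1 : ℝ) ≤ Real.exp 1 := Real.one_le_exp zero_le_one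
      have hE : 0 ≤ Real.exp P.WL := (Real.exp_pos _).le
      rw [pow_two]
      have : P.L * P.L / 2 ^ 18 * (Real.exp P.WL / (2 * Real.exp 1)) = (P.L * P.L * Real.exp P.WL) / (2 ^ 18 * (2 * Real.exp 1)) := by
        field_simp
      rw [this]
      exact div_le_self (by positivity) (by nlinarith)
    calc D1 * Bb * S.Dco F P ≤ D1 * (D1 ^ (S.d + 2) * (F.N * Real.exp P.W)) * (D1 ^ (S.d + 2) * (F.N * P.L)) := by
          gcongr
      _ = D1 ^ (2 * S.d + 5) * ((F.N * Real.exp P.W) * (F.N * P.L)) := by ring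
      _ ≤ D1 ^ (2 * S.d + 5) * ((P.L : ℝ) ^ 2 * Real.exp P.WL) := mul_le_mul_of_nonneg_left hcore (by positivity)
  have hbig : (1 : ℝ) ≤ D1 ^ (2 * S.d + 5) * ((P.L : ℝ) ^ 2 * Real.exp P.WL) := by
    have h1 : (1 : ℝ) ≤ D1 ^ (2 * S.d + 5) := one_le_pow₀ hd1
    have h2 : (1 : ℝ) ≤ (P.L : ℝ) ^ 2 := one_le_pow₀ P.one_le_L
    have h3 : (1 : ℝ) ≤ Real.exp P.WL := Real.one_le_exp (by linarith [P.WL_ge_one])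
    calc (1 : ℝ) = 1 * (1 * 1) := by ring
      _ ≤ _ := by gcongr
  have hX2 : (S.Xb3N F P I : ℝ) ≤ 2 * (D1 ^ (2 * S.d + 5) * ((P.L : ℝ) ^ 2 * Real.exp P.WL)) := by linarith
  have hXpos : (0 : ℝ) < (S.Xb3N F P I : ℝ) := by
    exact_mod_cast (show (0 : ℤ) < S.Xb3N F P I by have := S.one_le_Xb3N F P I; omega)
  -- `log(2L) ≤ W_L − 2` (`W ≥ 1`)
  have hlog2L : Real.log 2 + Real.log P.L ≤ P.WL - 2 := by
    have h := P.W_add_log_le_WL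
    rw [Real.log_mul (by norm_num) hL0.ne'] at h
    linarith [P.hW]
  calc Real.log (S.Xb3N F P I : ℝ) ≤ Real.log (2 * (D1 ^ (2 * S.d + 5) * ((P.L : ℝ) ^ 2 * Real.exp P.WL))) :=
        Real.log_le_log hXpos hX2
    _ = Real.log 2 + ((2 * (S.d : ℝ) + 5) * Real.log D1 + (2 * Real.log P.L + P.WL)) := by
        rw [Real.log_mul (by norm_num) (by positivity), Real.log_mul (by positivity) (by positivity),
          Real.log_mul (by positivity) (by positivity), Real.log_pow, Real.log_pow, Real.log_exp]
        push_cast; ring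
    _ ≤ 3 * P.WL + (2 * (S.d : ℝ) + 5) * Real.log ((S.d : ℝ) + 1) := by
        rw [hD1]
        have hlog2 : 0 ≤ Real.log 2 := Real.log_nonneg (by norm_num)
        nlinarith

/-- **`log N ≤ log L − G`** at `G = (m+2)·log 2` (`N ≤ (2/log 2)ⁿΩ`, `24·C_bⁿ·Ω·K ≤ L`, `K ≥ 2^m`, `(2/(log 2·C_b))ⁿ ≤ 1/22`).
[cite: Nesterenko2003, §3.4 Prop 3.7; shape only] -/
theorem log_N_le_sub_G (hG : P.G = (P.m + 2) * Real.log 2) (hN : (F.N : ℝ) ≤ (2 / Real.log 2) ^ (S.d + 1) * P.Ω) :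
    Real.log F.N ≤ Real.log P.L - P.G := by
  have h := P.main_le_L'
  have hl : (0.6931471803 : ℝ) < Real.log 2 := Real.log_two_gt_d9
  have hl1 : Real.log 2 < 0.6931471808 := Real.log_two_lt_d9
  have hCb := sixtyfour_le_Cb
  have hL : (0 : ℝ) < P.L := by linarith [P.one_le_L]
  have hΩ := P.Ω_pos
  have hN0 : (0 : ℝ) < F.N := by exact_mod_cast F.hN
  -- `K ≥ 2^m`
  have hK : (2 : ℝ) ^ P.m ≤ P.K := by
    have : 2 ^ P.m ≤ P.K := by
      unfold PadicG3Par.K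
      calc 2 ^ P.m ≤ P.p ^ P.m := Nat.pow_le_pow_left P.hp _
        _ ≤ P.p ^ P.m * P.K₀ := Nat.le_mul_of_pos_right _ P.hK₀
    exact_mod_cast this
  have hC : (0 : ℝ) < Cb ^ (S.d + 1) := by have := Cb_pos; positivity
  -- `N ≤ (q^{n} L)/(24·2^m)` with `q := 2/(log 2 · C_b) ≤ 1/22`
  have hq : 2 / Real.log 2 / Cb ≤ 1 / 22 := by
    rw [div_div, div_le_div_iff₀ (by have := Cb_pos; positivity) (by norm_num)]
    nlinarith
  have hq0 : 0 ≤ 2 / Real.log 2 / Cb := by have := Cb_pos; positivity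
  have hqn : (2 / Real.log 2 / Cb) ^ (S.d + 1) ≤ 1 / 22 := (pow_le_of_le_one hq0 (by linarith) (by omega)).trans hq
  have hΩ' : P.Ω * (24 * Cb ^ (S.d + 1) * (2 : ℝ) ^ P.m) ≤ P.L := by
    calc P.Ω * (24 * Cb ^ (S.d + 1) * (2 : ℝ) ^ P.m) ≤ P.Ω * (24 * Cb ^ (S.d + 1) * P.K) := by gcongr
      _ = 24 * Cb ^ (S.d + 1) * P.Ω * P.K := by ring
      _ ≤ P.L := h
  have hNle : (F.N : ℝ) * (22 * 24 * (2 : ℝ) ^ P.m) ≤ P.L := by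
    have e : (2 / Real.log 2) ^ (S.d + 1) = (2 / Real.log 2 / Cb) ^ (S.d + 1) * Cb ^ (S.d + 1) := by
      rw [← mul_pow]; congr 1; field_simp
    have h1 : (F.N : ℝ) ≤ (1 / 22) * Cb ^ (S.d + 1) * P.Ω := by
      calc (F.N : ℝ) ≤ (2 / Real.log 2) ^ (S.d + 1) * P.Ω := hN
        _ = (2 / Real.log 2 / Cb) ^ (S.d + 1) * Cb ^ (S.d + 1) * P.Ω := by rw [e]
        _ ≤ (1 / 22) * Cb ^ (S.d + 1) * P.Ω := by gcongr
    calc (F.N : ℝ) * (22 * 24 * (2 : ℝ) ^ P.m) ≤ (1 / 22) * Cb ^ (S.d + 1) * P.Ω * (22 * 24 * (2 : ℝ) ^ P.m) := by gcongr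
      _ = P.Ω * (24 * Cb ^ (S.d + 1) * (2 : ℝ) ^ P.m) := by ring
      _ ≤ P.L := hΩ'
  -- logs: `log N + log 528 + m log 2 ≤ log L`, and `G = (m+2) log 2 ≤ m log 2 + log 528`
  have hpos : (0 : ℝ) < 22 * 24 * (2 : ℝ) ^ P.m := by positivity
  have hlog := Real.log_le_log (by positivity) hNle
  rw [Real.log_mul hN0.ne' hpos.ne', Real.log_mul (by norm_num) (by positivity), Real.log_pow] at hlog
  have h528 : 2 * Real.log 2 ≤ Real.log (22 * 24) := by
    rw [show (22 : ℝ) * 24 = 2 ^ 9 + 16 by norm_num]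
    have : Real.log ((2 : ℝ) ^ 9) ≤ Real.log (2 ^ 9 + 16) := Real.log_le_log (by positivity) (by norm_num)
    rw [Real.log_pow] at this; push_cast at this; linarith
  rw [hG]; linarith

end TwoSetup

end Summit.ABC.StewartYu

end
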